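import Summits.Ventures.Crystal3D.Theorems.StickyWulffConstantPolycrystalWulffBoundCertHelpers

/-!
# `PolycrystalWulffBound`, line `PolyDensity`: the generic BOX step of the middle-band certificates

Route `StickyWulffConstant` of the venture `Summits/Ventures/Crystal3D`, crux `PolycrystalWulffBound`
(item `stmt-Ventures-19482`), second prover lane (poly-p2, gen 4).  One lemma doing the concavity step
of every box of HOME/poly-p2/BOXCERT3-27.80-tau0.0008.txt once and for all (`box_certificate`): for a
finite family of atoms `κ_r · (p_r V + q_r v₀ + s_r v₂)^{2/3}` with weights `y_r ≥ 0`, `κ_r ≥ 0`, and a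
box `a₁V ≤ v₀ ≤ b₁V`, `a₃V ≤ v₂ ≤ b₃V` on whose four corners the affine forms are `≥ 0` and the
combination is `≥ m` (per unit `V^{2/3}`), the combination is `≥ m·V^{2/3}` on the whole box
(bilinear corner weights + four-point Jensen for `u ↦ u^{2/3}`, atom by atom).  A typed box of the
certificate is then: this lemma + four numeric corner checks (`rpow_twoThirds_lb`) + `linarith` over the
LP rows.
WHAT THIS IS NOT: any specific box; F-C1 not moved.
-/

noncomputable section

namespace Summit.Ventures.Crystal3D.Theorems

open Real Finset

/-- **Generic box step.**  See the module docstring; the corners are `(a₁,a₃), (a₁,b₃), (b₁,a₃), (b₁,b₃)`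
in the chart `(v₀/V, v₂/V)`. -/
theorem box_certificate {R : ℕ} (y κ p q s : Fin R → ℝ) (hy : ∀ r, 0 ≤ y r) (hκ : ∀ r, 0 ≤ κ r)
    {V a₁ b₁ a₃ b₃ v₀ v₂ m : ℝ} (hV : 0 < V) (hab₁ : a₁ < b₁) (hab₃ : a₃ < b₃)
    (h₀ : a₁ * V ≤ v₀) (h₀' : v₀ ≤ b₁ * V) (h₂ : a₃ * V ≤ v₂) (h₂' : v₂ ≤ b₃ * V)
    (hnn₁ : ∀ r, 0 ≤ p r + q r * a₁ + s r * a₃) (hnn₂ : ∀ r, 0 ≤ p r + q r * a₁ + s r * b₃)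
    (hnn₃ : ∀ r, 0 ≤ p r + q r * b₁ + s r * a₃) (hnn₄ : ∀ r, 0 ≤ p r + q r * b₁ + s r * b₃)
    (hc₁ : m ≤ ∑ r, y r * κ r * (p r + q r * a₁ + s r * a₃) ^ ((2 : ℝ) / 3))
    (hc₂ : m ≤ ∑ r, y r * κ r * (p r + q r * a₁ + s r * b₃) ^ ((2 : ℝ) / 3))
    (hc₃ : m ≤ ∑ r, y r * κ r * (p r + q r * b₁ + s r * a₃) ^ ((2 : ℝ) / 3))
    (hc₄ : m ≤ ∑ r, y r * κ r * (p r + q r * b₁ + s r * b₃) ^ ((2 : ℝ) / 3)) :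
    m * V ^ ((2 : ℝ) / 3) ≤ ∑ r, y r * κ r * (p r * V + q r * v₀ + s r * v₂) ^ ((2 : ℝ) / 3) := by
  -- bilinear weights of `(v₀, v₂)` in the box `[a₁V, b₁V] × [a₃V, b₃V]`
  obtain ⟨w₁, w₂, w₃, w₄, hw₁, hw₂, hw₃, hw₄, hsum, hs, ht⟩ :=
    bilinear_weights (mul_lt_mul_of_pos_right hab₁ hV) (mul_lt_mul_of_pos_right hab₃ hV) h₀ h₀' h₂ h₂'
  have hV0 : 0 ≤ V := hV.le
  have hV23 : 0 ≤ V ^ ((2 : ℝ) / 3) := by positivity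
  -- corner values of the affine forms
  have hcorner : ∀ (c₁ c₃ : ℝ) (r : Fin R), 0 ≤ p r + q r * c₁ + s r * c₃ →
      (p r * V + q r * (c₁ * V) + s r * (c₃ * V)) ^ ((2 : ℝ) / 3) =
        (p r + q r * c₁ + s r * c₃) ^ ((2 : ℝ) / 3) * V ^ ((2 : ℝ) / 3) := by
    intro c₁ c₃ r hnn
    rw [show p r * V + q r * (c₁ * V) + s r * (c₃ * V) = (p r + q r * c₁ + s r * c₃) * V by ring,
      Real.mul_rpow hnn hV0]
  -- atom by atom: Jensen
  have hatom : ∀ r, w₁ * ((p r + q r * a₁ + s r * a₃) ^ ((2 : ℝ) / 3) * V ^ ((2 : ℝ) / 3)) +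
      w₂ * ((p r + q r * a₁ + s r * b₃) ^ ((2 : ℝ) / 3) * V ^ ((2 : ℝ) / 3)) +
      w₃ * ((p r + q r * b₁ + s r * a₃) ^ ((2 : ℝ) / 3) * V ^ ((2 : ℝ) / 3)) +
      w₄ * ((p r + q r * b₁ + s r * b₃) ^ ((2 : ℝ) / 3) * V ^ ((2 : ℝ) / 3)) ≤
      (p r * V + q r * v₀ + s r * v₂) ^ ((2 : ℝ) / 3) := by
    intro r
    rw [← hcorner a₁ a₃ r (hnn₁ r), ← hcorner a₁ b₃ r (hnn₂ r), ← hcorner b₁ a₃ r (hnn₃ r),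
      ← hcorner b₁ b₃ r (hnn₄ r)]
    have hu₁ : 0 ≤ p r * V + q r * (a₁ * V) + s r * (a₃ * V) := by
      rw [show p r * V + q r * (a₁ * V) + s r * (a₃ * V) = (p r + q r * a₁ + s r * a₃) * V by ring]
      exact mul_nonneg (hnn₁ r) hV0
    have hu₂ : 0 ≤ p r * V + q r * (a₁ * V) + s r * (b₃ * V) := by
      rw [show p r * V + q r * (a₁ * V) + s r * (b₃ * V) = (p r + q r * a₁ + s r * b₃) * V by ring]
      exact mul_nonneg (hnn₂ r) hV0
    have hu₃ : 0 ≤ p r * V + q r * (b₁ * V) + s r * (a₃ * V) := by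
      rw [show p r * V + q r * (b₁ * V) + s r * (a₃ * V) = (p r + q r * b₁ + s r * a₃) * V by ring]
      exact mul_nonneg (hnn₃ r) hV0
    have hu₄ : 0 ≤ p r * V + q r * (b₁ * V) + s r * (b₃ * V) := by
      rw [show p r * V + q r * (b₁ * V) + s r * (b₃ * V) = (p r + q r * b₁ + s r * b₃) * V by ring]
      exact mul_nonneg (hnn₄ r) hV0
    have hJ := jensen4_rpow_twoThirds hw₁ hw₂ hw₃ hw₄ hsum hu₁ hu₂ hu₃ hu₄
    have heq : w₁ * (p r * V + q r * (a₁ * V) + s r * (a₃ * V)) +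
        w₂ * (p r * V + q r * (a₁ * V) + s r * (b₃ * V)) +
        w₃ * (p r * V + q r * (b₁ * V) + s r * (a₃ * V)) +
        w₄ * (p r * V + q r * (b₁ * V) + s r * (b₃ * V)) = p r * V + q r * v₀ + s r * v₂ := by
      have e1 : p r * V * (w₁ + w₂ + w₃ + w₄) = p r * V := by rw [hsum, mul_one]
      linear_combination e1 + q r * hs + s r * ht
    rw [heq] at hJ
    exact hJ
  -- weight the atoms by `y r * κ r ≥ 0` and sum
  have hsumle : ∑ r, y r * κ r * (w₁ * ((p r + q r * a₁ + s r * a₃) ^ ((2 : ℝ) / 3) * V ^ ((2 : ℝ) / 3)) +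
      w₂ * ((p r + q r * a₁ + s r * b₃) ^ ((2 : ℝ) / 3) * V ^ ((2 : ℝ) / 3)) +
      w₃ * ((p r + q r * b₁ + s r * a₃) ^ ((2 : ℝ) / 3) * V ^ ((2 : ℝ) / 3)) +
      w₄ * ((p r + q r * b₁ + s r * b₃) ^ ((2 : ℝ) / 3) * V ^ ((2 : ℝ) / 3))) ≤
      ∑ r, y r * κ r * (p r * V + q r * v₀ + s r * v₂) ^ ((2 : ℝ) / 3) :=
    Finset.sum_le_sum fun r _ => mul_le_mul_of_nonneg_left (hatom r) (mul_nonneg (hy r) (hκ r))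
  -- regroup by corners
  have hregroup : (∑ r, y r * κ r * (w₁ * ((p r + q r * a₁ + s r * a₃) ^ ((2 : ℝ) / 3) * V ^ ((2 : ℝ) / 3)) +
      w₂ * ((p r + q r * a₁ + s r * b₃) ^ ((2 : ℝ) / 3) * V ^ ((2 : ℝ) / 3)) +
      w₃ * ((p r + q r * b₁ + s r * a₃) ^ ((2 : ℝ) / 3) * V ^ ((2 : ℝ) / 3)) +
      w₄ * ((p r + q r * b₁ + s r * b₃) ^ ((2 : ℝ) / 3) * V ^ ((2 : ℝ) / 3)))) =
      (w₁ * (∑ r, y r * κ r * (p r + q r * a₁ + s r * a₃) ^ ((2 : ℝ) / 3)) +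
       w₂ * (∑ r, y r * κ r * (p r + q r * a₁ + s r * b₃) ^ ((2 : ℝ) / 3)) +
       w₃ * (∑ r, y r * κ r * (p r + q r * b₁ + s r * a₃) ^ ((2 : ℝ) / 3)) +
       w₄ * (∑ r, y r * κ r * (p r + q r * b₁ + s r * b₃) ^ ((2 : ℝ) / 3))) * V ^ ((2 : ℝ) / 3) := by
    rw [Finset.mul_sum, Finset.mul_sum, Finset.mul_sum, Finset.mul_sum, add_mul, add_mul, add_mul,
      Finset.sum_mul, Finset.sum_mul, Finset.sum_mul, Finset.sum_mul, ← Finset.sum_add_distrib,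
      ← Finset.sum_add_distrib, ← Finset.sum_add_distrib]
    exact Finset.sum_congr rfl fun r _ => by ring
  rw [hregroup] at hsumle
  have hcomb : m ≤ w₁ * (∑ r, y r * κ r * (p r + q r * a₁ + s r * a₃) ^ ((2 : ℝ) / 3)) +
      w₂ * (∑ r, y r * κ r * (p r + q r * a₁ + s r * b₃) ^ ((2 : ℝ) / 3)) +
      w₃ * (∑ r, y r * κ r * (p r + q r * b₁ + s r * a₃) ^ ((2 : ℝ) / 3)) +
      w₄ * (∑ r, y r * κ r * (p r + q r * b₁ + s r * b₃) ^ ((2 : ℝ) / 3)) :=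
    ge_of_corner_bounds hw₁ hw₂ hw₃ hw₄ hsum le_rfl hc₁ hc₂ hc₃ hc₄
  calc m * V ^ ((2 : ℝ) / 3) ≤ (w₁ * (∑ r, y r * κ r * (p r + q r * a₁ + s r * a₃) ^ ((2 : ℝ) / 3)) +
       w₂ * (∑ r, y r * κ r * (p r + q r * a₁ + s r * b₃) ^ ((2 : ℝ) / 3)) +
       w₃ * (∑ r, y r * κ r * (p r + q r * b₁ + s r * a₃) ^ ((2 : ℝ) / 3)) +
       w₄ * (∑ r, y r * κ r * (p r + q r * b₁ + s r * b₃) ^ ((2 : ℝ) / 3))) * V ^ ((2 : ℝ) / 3) :=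
        mul_le_mul_of_nonneg_right hcomb hV23
    _ ≤ _ := hsumle

end Summit.Ventures.Crystal3D.Theorems

end
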